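import Literature.MathematicalPhysics.QuantumLattice.HubbardSliceSymbolSmoothXiThird
import Literature.Analysis.Calculus.ThirdOrderChainRule
import Literature.Analysis.Calculus.IteratedDifferenceBound
import HarnessLib

/-!
# The slice symbol read along a `C³` real curve of band values: the order-three derivative chain and the bound
# `‖(Ψ̂ ∘ u)‴‖ ≤ (K₃D³ + 3K₂D·D₂ + K₁D₃)·c` with `K_i ≲ Λ^{-(i+1)}`; third DIFFERENCES along the curve

Topic `MathematicalPhysics/QuantumLattice`; continues `HubbardSliceSymbolSmoothXiThird` (`Ψ̂_ω(ξ)` is `C³` in `ξ` with `‖Ψ̂′‖ ≤ (16B₁+16)c/Λ²`,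
`‖Ψ̂″‖ ≤ (32B₂+144B₁+128)c/Λ³`, `‖Ψ̂‴‖ ≤ (64B₃+480B₂+1728B₁+1536)c/Λ⁴`) with the generic `Literature.Analysis.Calculus.ThirdOrderChainRule`.  Along
a grid direction the padded slice symbol of a FRAMED band is `t ↦ Ψ̂_ω(u(t))` with `u(t) = e_K(p + t·v)` a `C³` real curve (the band side:
Benfatto–Giuliani–Mastropietro 2006, §3 (3.2)–(3.8), partial frames of the telescoping); its third differences — the input of the weighted `ℓ¹`
bounds of the sectorised slice propagators (`…TorusL1ThirdDifferencesMoment`) — are bounded by the third derivative of the composite (the iterated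
mean value inequality `IteratedDifferenceBound.norm_fwdDiff_iter_le_of_hasDerivAt`):

* `hasDerivAt_sliceSymbolFnXi_comp_chain` — the chain `G 0 … G 3` of `Ψ̂ ∘ u` (instance of `hasDerivAt_chain3_comp`);
* **`norm_sliceSymbolFnXi_comp_deriv3_le`** — `‖G 3 t‖ ≤ (K₃|u₁|³ + 3K₂|u₁||u₂| + K₁|u₃|)` with the three constants of the slice symbol;
* **`norm_fwdDiff_iter_three_sliceSymbolFnXi_comp_le`** — `‖Δ_δ³(Ψ̂ ∘ u)(t)‖ ≤ δ³·(K₃D₁³ + 3K₂D₁D₂ + K₁D₃)` when `|u₁| ≤ D₁`, `|u₂| ≤ D₂`, `|u₃| ≤ D₃`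
  everywhere (`δ ≥ 0`).

Everything is proved; no definitions; no named facts.

## Sources

G. Benfatto, A. Giuliani, V. Mastropietro, Ann. Henri Poincaré 7 (2006) 809–898, (2.36aa), §3 (3.2)–(3.8) (`BenfattoGiulianiMastropietro2006`);
M. Salmhofer, *Renormalization* (1999), §4.2.5 (4.70) (`Salmhofer1999`).
-/

noncomputable section

namespace Literature.MathematicalPhysics.QuantumLattice

open Literature.Probability.LatticeModels Literature.Analysis.Calculus Set Complex

section BandChain

variable {c θ Λ Λ' ω : ℝ}

/-- **The order-three chain of the slice symbol along a `C³` real curve** `u` (derivatives `u₁, u₂, u₃` everywhere): with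
`G 0 = Ψ̂ ∘ u`, `G 1 = Ψ̂′(u)·u₁`, `G 2 = Ψ̂″(u)·u₁² + Ψ̂′(u)·u₂`, `G 3 = Ψ̂‴(u)·u₁³ + 3Ψ̂″(u)·u₁u₂ + Ψ̂′(u)·u₃`, `HasDerivAt (G k) (G (k+1) t) t` for
`k < 3` (`0 < Λ ≤ Λ′`, `|θ| ≤ Λ/4`). [cite: BenfattoGiulianiMastropietro2006, (2.36aa)] -/
theorem hasDerivAt_sliceSymbolFnXi_comp_chain (hΛ : 0 < Λ) (hΛΛ' : Λ ≤ Λ') (hθ : |θ| ≤ Λ / 4) {u u₁ u₂ u₃ : ℝ → ℝ}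
    (hu : ∀ t, HasDerivAt u (u₁ t) t) (hu₁ : ∀ t, HasDerivAt u₁ (u₂ t) t) (hu₂ : ∀ t, HasDerivAt u₂ (u₃ t) t) :
    let G : ℕ → ℝ → ℂ := fun k t =>
      if k = 0 then sliceSymbolFnXi c θ Λ Λ' ω (u t)
      else if k = 1 then sliceSymbolFnXiD1 c θ Λ Λ' ω (u t) * (u₁ t : ℂ)
      else if k = 2 then sliceSymbolFnXiD2 c θ Λ Λ' ω (u t) * (u₁ t : ℂ) ^ 2 + sliceSymbolFnXiD1 c θ Λ Λ' ω (u t) * (u₂ t : ℂ)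
      else if k = 3 then sliceSymbolFnXiD3 c θ Λ Λ' ω (u t) * (u₁ t : ℂ) ^ 3 +
        3 * (sliceSymbolFnXiD2 c θ Λ Λ' ω (u t) * (u₁ t : ℂ) * (u₂ t : ℂ)) + sliceSymbolFnXiD1 c θ Λ Λ' ω (u t) * (u₃ t : ℂ)
      else 0
    ∀ k < 3, ∀ t, HasDerivAt (G k) (G (k + 1) t) t :=
  hasDerivAt_chain3_comp (fun x => hasDerivAt_sliceSymbolFnXi hΛ hΛΛ' hθ x) (fun x => hasDerivAt_sliceSymbolFnXiD1 hΛ hΛΛ' hθ x)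
    (fun x => hasDerivAt_sliceSymbolFnXiD2 hΛ hΛΛ' hθ x) hu hu₁ hu₂

/-- **The Faà di Bruno bound of the slice symbol along a curve**:
`‖Ψ̂‴(x)·a³ + 3Ψ̂″(x)·ab + Ψ̂′(x)·b′‖ ≤ K₃|a|³ + 3K₂|a||b| + K₁|b′|` with `K₁ = (16B₁+16)c/Λ²`, `K₂ = (32B₂+144B₁+128)c/Λ³`,
`K₃ = (64B₃+480B₂+1728B₁+1536)c/Λ⁴`. [cite: BenfattoGiulianiMastropietro2006, (2.36aa)] -/
theorem norm_sliceSymbolFnXi_comp_deriv3_le (hΛ : 0 < Λ) (hΛΛ' : Λ ≤ Λ') (hθ : |θ| ≤ Λ / 4) (hc : 0 ≤ c) {B₁ B₂ B₃ : ℝ}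
    (hB₁ : ∀ x, |deriv salmhoferCutoff x| ≤ B₁) (hB₂ : ∀ x, |deriv (deriv salmhoferCutoff) x| ≤ B₂)
    (hB₃ : ∀ x, |deriv (deriv (deriv salmhoferCutoff)) x| ≤ B₃) (x a b b' : ℝ) :
    ‖sliceSymbolFnXiD3 c θ Λ Λ' ω x * (a : ℂ) ^ 3 + 3 * (sliceSymbolFnXiD2 c θ Λ Λ' ω x * (a : ℂ) * (b : ℂ)) +
        sliceSymbolFnXiD1 c θ Λ Λ' ω x * (b' : ℂ)‖ ≤
      (64 * B₃ + 480 * B₂ + 1728 * B₁ + 1536) * c / Λ ^ 4 * |a| ^ 3 +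
        3 * ((32 * B₂ + 144 * B₁ + 128) * c / Λ ^ 3 * |a| * |b|) + (16 * B₁ + 16) * c / Λ ^ 2 * |b'| :=
  norm_chain3_three_le (fun y => norm_sliceSymbolFnXiD1_le hΛ hΛΛ' hθ hc hB₁ y) (fun y => norm_sliceSymbolFnXiD2_le hΛ hΛΛ' hθ hc hB₁ hB₂ y)
    (fun y => norm_sliceSymbolFnXiD3_le hΛ hΛΛ' hθ hc hB₁ hB₂ hB₃ y) x a b b'

/-- **Third differences of the slice symbol along a `C³` curve**: if `|u₁| ≤ D₁`, `|u₂| ≤ D₂`, `|u₃| ≤ D₃` everywhere then for `δ ≥ 0`,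
`‖Δ_δ³ (Ψ̂ ∘ u)(t)‖ ≤ δ³·(K₃D₁³ + 3K₂D₁D₂ + K₁D₃)` (iterated mean value inequality along the chain). [cite: BenfattoGiulianiMastropietro2006, (2.36aa)] -/
theorem norm_fwdDiff_iter_three_sliceSymbolFnXi_comp_le (hΛ : 0 < Λ) (hΛΛ' : Λ ≤ Λ') (hθ : |θ| ≤ Λ / 4) (hc : 0 ≤ c) {B₁ B₂ B₃ : ℝ}
    (hB₁ : ∀ x, |deriv salmhoferCutoff x| ≤ B₁) (hB₂ : ∀ x, |deriv (deriv salmhoferCutoff) x| ≤ B₂)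
    (hB₃ : ∀ x, |deriv (deriv (deriv salmhoferCutoff)) x| ≤ B₃) {u u₁ u₂ u₃ : ℝ → ℝ}
    (hu : ∀ t, HasDerivAt u (u₁ t) t) (hu₁ : ∀ t, HasDerivAt u₁ (u₂ t) t) (hu₂ : ∀ t, HasDerivAt u₂ (u₃ t) t)
    {D₁ D₂ D₃ : ℝ} (hD₁ : ∀ t, |u₁ t| ≤ D₁) (hD₂ : ∀ t, |u₂ t| ≤ D₂) (hD₃ : ∀ t, |u₃ t| ≤ D₃) {δ : ℝ} (hδ : 0 ≤ δ) (t : ℝ) :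
    ‖(fwdDiff δ)^[3] (fun s => sliceSymbolFnXi c θ Λ Λ' ω (u s)) t‖ ≤
      δ ^ 3 * ((64 * B₃ + 480 * B₂ + 1728 * B₁ + 1536) * c / Λ ^ 4 * D₁ ^ 3 +
        3 * ((32 * B₂ + 144 * B₁ + 128) * c / Λ ^ 3 * D₁ * D₂) + (16 * B₁ + 16) * c / Λ ^ 2 * D₃) := by
  have hB10 : 0 ≤ B₁ := (abs_nonneg _).trans (hB₁ 0)
  have hB20 : 0 ≤ B₂ := (abs_nonneg _).trans (hB₂ 0)
  have hB30 : 0 ≤ B₃ := (abs_nonneg _).trans (hB₃ 0)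
  have hD10 : 0 ≤ D₁ := (abs_nonneg _).trans (hD₁ 0)
  have hD20 : 0 ≤ D₂ := (abs_nonneg _).trans (hD₂ 0)
  set G : ℕ → ℝ → ℂ := fun k t =>
      if k = 0 then sliceSymbolFnXi c θ Λ Λ' ω (u t)
      else if k = 1 then sliceSymbolFnXiD1 c θ Λ Λ' ω (u t) * (u₁ t : ℂ)
      else if k = 2 then sliceSymbolFnXiD2 c θ Λ Λ' ω (u t) * (u₁ t : ℂ) ^ 2 + sliceSymbolFnXiD1 c θ Λ Λ' ω (u t) * (u₂ t : ℂ)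
      else if k = 3 then sliceSymbolFnXiD3 c θ Λ Λ' ω (u t) * (u₁ t : ℂ) ^ 3 +
        3 * (sliceSymbolFnXiD2 c θ Λ Λ' ω (u t) * (u₁ t : ℂ) * (u₂ t : ℂ)) + sliceSymbolFnXiD1 c θ Λ Λ' ω (u t) * (u₃ t : ℂ)
      else 0 with hG
  have hchain : ∀ k < 3, ∀ t, HasDerivAt (G k) (G (k + 1) t) t :=
    hasDerivAt_sliceSymbolFnXi_comp_chain (c := c) (ω := ω) hΛ hΛΛ' hθ hu hu₁ hu₂
  set K : ℝ := (64 * B₃ + 480 * B₂ + 1728 * B₁ + 1536) * c / Λ ^ 4 * D₁ ^ 3 +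
      3 * ((32 * B₂ + 144 * B₁ + 128) * c / Λ ^ 3 * D₁ * D₂) + (16 * B₁ + 16) * c / Λ ^ 2 * D₃ with hK
  have hbound : ∀ s, ‖G 3 s‖ ≤ K := by
    intro s
    have h3 : G 3 s = sliceSymbolFnXiD3 c θ Λ Λ' ω (u s) * (u₁ s : ℂ) ^ 3 +
        3 * (sliceSymbolFnXiD2 c θ Λ Λ' ω (u s) * (u₁ s : ℂ) * (u₂ s : ℂ)) + sliceSymbolFnXiD1 c θ Λ Λ' ω (u s) * (u₃ s : ℂ) := by
      simp [hG]
    rw [h3]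
    refine (norm_sliceSymbolFnXi_comp_deriv3_le hΛ hΛΛ' hθ hc hB₁ hB₂ hB₃ (u s) (u₁ s) (u₂ s) (u₃ s)).trans ?_
    have k1 : 0 ≤ (64 * B₃ + 480 * B₂ + 1728 * B₁ + 1536) * c / Λ ^ 4 := by positivity
    have k2 : 0 ≤ (32 * B₂ + 144 * B₁ + 128) * c / Λ ^ 3 := by positivity
    have k3 : 0 ≤ (16 * B₁ + 16) * c / Λ ^ 2 := by positivity
    have e1 : |u₁ s| ^ 3 ≤ D₁ ^ 3 := pow_le_pow_left₀ (abs_nonneg _) (hD₁ s) 3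
    have e2 : |u₁ s| * |u₂ s| ≤ D₁ * D₂ := mul_le_mul (hD₁ s) (hD₂ s) (abs_nonneg _) hD10
    rw [hK]
    refine add_le_add (add_le_add (mul_le_mul_of_nonneg_left e1 k1) (mul_le_mul_of_nonneg_left ?_ (by norm_num)))
      (mul_le_mul_of_nonneg_left (hD₃ s) k3)
    rw [mul_assoc, mul_assoc]
    exact mul_le_mul_of_nonneg_left e2 k2
  have h := Literature.Analysis.norm_fwdDiff_iter_le_of_hasDerivAt hδ 3 G t K (fun k hk s _ => hchain k hk s) (fun s _ => hbound s)
  have h0 : G 0 = fun s => sliceSymbolFnXi c θ Λ Λ' ω (u s) := by funext s; simp [hG]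
  rw [h0] at h
  exact h

end BandChain

end Literature.MathematicalPhysics.QuantumLattice

end
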